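import Literature.MathematicalPhysics.QuantumLattice.FockGaugeAction
import Literature.MathematicalPhysics.QuantumLattice.TIGroundEnergyDensityResponse
import HarnessLib

/-!
# The `U(1)` gauge action on infinite-volume fermion states: gauge transforms, gauge-invariant
# (symmetric) states, the gauge average, and the invariance of mean energy and ground states

Topic `Literature/MathematicalPhysics/QuantumLattice` (namespace = path). Seat `hubbard-cq-p4` (cell
`pub/hubbard-cq`); sequel of `FockGaugeAction.lean` (the gauge automorphisms `γ_θ` of the local CAR
algebras, charges, and the particle-number pinching `E = gradedCompress Finset.card` as the
conditional expectation onto the gauge-invariant algebra, all commuting with the structure maps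
`Γ(φ)`). This is the «gauge action on infinite-volume states» recorded as missing in
`DWaveOrderParameterSymmetricRange.lean` (hubbard-cq-p5). Everything is PROVED; no named fact.

## Contents (carrier `InfVolFermionState d`)

* INTERACTIONS: `FermionInteraction.IsGaugeInvariant` (every term fixed by every `γ_θ`), with
  `gaugeAut_meanEnergyObs` / `gradedCompress_meanEnergyObs` / `gaugeAut_localHamiltonian`, closure under
  pencils and pointwise sums, and the instances: `numberInteraction`, `hubbardFermionInteraction`,
  `diagHoppingFermionInteraction`, `hubbardTTPrimeFermionInteraction`, **`hubbardTTPrimeMuInteraction`**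
  (the grand-canonical `t–t'` Hubbard pencil) are gauge invariant; the local singlet pair
  `localPairAt S g x` has charge `−2` (`hasGaugeCharge_localPairAt`).
* STATES: `gaugeShift θ ω = ω ∘ γ_θ` (a state; group law; `gaugeShift_expect_of_hasGaugeCharge`:
  multiplies a charge-`q` expectation by `e^{iqθ}`; commutes with translations `shift_gaugeShift`, so
  translation invariance, evenness and mixtures are preserved); `IsGaugeInvariant ω` (`ω ∘ γ_θ = ω`
  for all `θ`) with **`IsGaugeInvariant.expect_eq_zero_of_hasGaugeCharge`** (a symmetric state vanishes
  on every charged observable) and `IsGaugeInvariant.isEven` (`Θ = γ_π`);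
  **`gaugeAverage ω = ω ∘ E`** (`= ∫ ω∘γ_θ dθ/2π`; a state by `E(A⋆A) = Σ_n (AP_n)⋆(AP_n)` and
  `Γ(φ)∘E = E∘Γ(φ)`): gauge invariant, `= ω` on gauge-invariant observables and `= 0` on charged
  ones, constant on gauge orbits, commutes with translations (`IsTranslationInvariant.gaugeAverage`),
  even, affine, and `IsGaugeInvariant ω ↔ gaugeAverage ω = ω`.
* MEAN ENERGY / GROUND STATES (gauge-invariant interaction `Φ`): `meanEnergy_gaugeShift`,
  `meanEnergy_gaugeAverage` (`e_Φ(ω∘γ_θ) = e_Φ(ω̄) = e_Φ(ω)`), hence **`IsMeanEnergyMinimiser.gaugeShift`**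
  and **`IsMeanEnergyMinimiser.gaugeAverage`**: gauge transforms and the gauge average of a
  translation-invariant ground state are translation-invariant ground states; `IsMeanEnergyMinimiser.mix`
  (minimisers are convex).
* PAIR AMPLITUDES: `gaugeShift_expect_localPairAt` (`(ω∘γ_θ)(P_x) = e^{-2iθ} ω(P_x)`),
  `IsGaugeInvariant.expect_localPairAt_eq_zero`, `gaugeAverage_expect_localPairAt` (`ω̄(P_x) = 0`).

## References
* O. Bratteli, D. W. Robinson, *Operator Algebras and Quantum Statistical Mechanics 2*, 2nd ed. (1997),
  §5.2.2 (gauge group of the CAR algebra, gauge-invariant states). [cite: BratteliRobinsonII1997, §5.2.2]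
* O. Bratteli, D. W. Robinson, *Operator Algebras and Quantum Statistical Mechanics 1*, 2nd ed. (1987),
  §4.3.1 (`G`-invariant states, convexity). [cite: BratteliRobinsonI1987, §4.3.1]
* H. Araki, H. Moriya, Rev. Math. Phys. 15 (2003) 93, §4.1 Def. 4.3/4.5 (translations, invariant and
  even states). [cite: ArakiMoriya2003, §4.1]
* O. Bratteli, A. Kishimoto, D. W. Robinson, CMP 64 (1978) 41, §3 and Thm. 2 (mean energy, invariant
  ground states = minimisers). [cite: BratteliKishimotoRobinson1978, Thm. 2]
* D. Petz, *Quantum Information Theory and Quantum Statistics* (2008), §9.2 (conditional expectations,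
  group averages). [cite: Petz2008, §9.2]
* H. Tasaki, *Physics and Mathematics of Quantum Many-Body Systems* (2020), §9.2. [cite: Tasaki2020, §9.2]
-/

noncomputable section

namespace Literature.MathematicalPhysics.QuantumLattice

open _root_.Matrix Finset Complex Literature.LinearAlgebra.Matrix Literature.Probability.LatticeModels
open scoped ComplexOrder

/-! ## Gauge invariance of interactions -/

namespace FermionInteraction

variable {d : ℕ}

/-- `Φ` is **gauge invariant**: every term is fixed by every `γ_θ` (equivalently has charge `0`;
number-conserving interactions). [cite: BratteliRobinsonII1997, §5.2.2] -/
def IsGaugeInvariant (Ψ : FermionInteraction d) : Prop :=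
  ∀ (θ : ℝ) (X : Finset (Site d)), gaugeAut θ (Ψ.Φ X) = Ψ.Φ X

/-- The mean-energy observable of a gauge-invariant interaction is gauge invariant.
[cite: BratteliKishimotoRobinson1978, §3 (mean energy functional)] -/
theorem gaugeAut_meanEnergyObs {Ψ : FermionInteraction d} (h : Ψ.IsGaugeInvariant) (R θ : ℝ) :
    gaugeAut θ (Ψ.meanEnergyObs R) = Ψ.meanEnergyObs R := by
  unfold meanEnergyObs
  rw [map_sum]
  exact Finset.sum_congr rfl fun X _ => by rw [map_smul, ← fermionEmbed_gaugeAut, h θ X.1]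

/-- … hence it is its own particle-number pinching. [cite: Petz2008, §9.2] -/
theorem gradedCompress_meanEnergyObs {Ψ : FermionInteraction d} (h : Ψ.IsGaugeInvariant) (R : ℝ) :
    gradedCompress Finset.card (Ψ.meanEnergyObs R) = Ψ.meanEnergyObs R :=
  gradedCompress_eq_self_iff_forall_gaugeAut.2 fun θ => gaugeAut_meanEnergyObs h R θ

/-- The local Hamiltonians of a gauge-invariant interaction are gauge invariant.
[cite: BratteliRobinsonII1997, §5.2.2] -/
theorem gaugeAut_localHamiltonian {Ψ : FermionInteraction d} (h : Ψ.IsGaugeInvariant) (Λ : Finset (Site d))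
    (θ : ℝ) : gaugeAut θ (Ψ.localHamiltonian Λ) = Ψ.localHamiltonian Λ := by
  unfold localHamiltonian
  rw [map_sum]
  exact Finset.sum_congr rfl fun X _ => by rw [← fermionEmbed_gaugeAut, h θ X.1]

/-- A pencil of gauge-invariant interactions is gauge invariant. [cite: BratteliRobinsonII1997, §5.2.2] -/
theorem isGaugeInvariant_pencil {Ψ₀ Ψ₁ : FermionInteraction d} (h₀ : Ψ₀.IsGaugeInvariant)
    (h₁ : Ψ₁.IsGaugeInvariant) (s : ℝ) : (pencil Ψ₀ Ψ₁ s).IsGaugeInvariant := fun θ X => by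
  rw [pencil_apply, map_add, map_smul, h₀ θ X, h₁ θ X]

/-- A pointwise sum of gauge-invariant interactions is gauge invariant. [cite: BratteliRobinsonII1997, §5.2.2] -/
theorem isGaugeInvariant_of_add {Ψ Ψ₁ Ψ₂ : FermionInteraction d} (h : ∀ X, Ψ.Φ X = Ψ₁.Φ X + Ψ₂.Φ X)
    (h₁ : Ψ₁.IsGaugeInvariant) (h₂ : Ψ₂.IsGaugeInvariant) : Ψ.IsGaugeInvariant := fun θ X => by
  rw [h X, map_add, h₁ θ X, h₂ θ X]

end FermionInteraction

/-! ### The Hubbard interactions are gauge invariant -/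

section Hubbard

variable {d : ℕ}

/-- `γ_θ` fixes the number operators `n_{xσ}` of a region. [cite: Tasaki2020, §9.2] -/
theorem gaugeAut_nAt (θ : ℝ) {Λ : Finset (Site d)} (x : Site d) (hx : x ∈ Λ) (σ : Fin 2) :
    gaugeAut θ (nAt x hx σ) = nAt x hx σ := by
  rw [nAt, numberOp, gaugeAut_creation_mul_annihilation]

/-- `γ_θ` fixes the hopping words `c†_{xσ} c_{yσ}` of a region. [cite: BratteliRobinsonII1997, §5.2.2] -/
theorem gaugeAut_cAt_conjTranspose_mul_cAt (θ : ℝ) {Λ : Finset (Site d)} (x y : Site d) (hx : x ∈ Λ)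
    (hy : y ∈ Λ) (σ τ : Fin 2) : gaugeAut θ ((cAt x hx σ)ᴴ * cAt y hy τ) = (cAt x hx σ)ᴴ * cAt y hy τ := by
  rw [cAt, cAt, annihilation_conjTranspose, gaugeAut_creation_mul_annihilation]

/-- **The particle-number interaction is gauge invariant.** [cite: BratteliRobinsonII1997, §5.2.2] -/
theorem numberInteraction_isGaugeInvariant : (numberInteraction d).IsGaugeInvariant := by
  intro θ X
  simp only [numberInteraction, map_sum, apply_ite (gaugeAut θ), map_zero, map_add, gaugeAut_nAt]

/-- **The Hubbard interaction is gauge invariant** (every term conserves the particle number).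
[cite: BratteliRobinsonII1997, §5.2.2] -/
theorem hubbardFermionInteraction_isGaugeInvariant (t U : ℝ) :
    (hubbardFermionInteraction d t U).IsGaugeInvariant := by
  intro θ X
  have hnn : ∀ (x : Site d) (hx : x ∈ X), gaugeAut θ (nAt x hx 0 * nAt x hx 1) = nAt x hx 0 * nAt x hx 1 :=
    fun x hx => by rw [map_mul, gaugeAut_nAt, gaugeAut_nAt]
  simp only [hubbardFermionInteraction, map_add, map_sum, apply_ite (gaugeAut θ), map_zero, map_smul,
    hnn, gaugeAut_cAt_conjTranspose_mul_cAt]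

/-- **The diagonal (`t'`) hopping interaction is gauge invariant.** [cite: BratteliRobinsonII1997, §5.2.2] -/
theorem diagHoppingFermionInteraction_isGaugeInvariant (t' : ℝ) :
    (diagHoppingFermionInteraction t').IsGaugeInvariant := by
  intro θ X
  simp only [diagHoppingFermionInteraction, map_sum, apply_ite (gaugeAut θ), map_zero, map_smul, map_add,
    gaugeAut_cAt_conjTranspose_mul_cAt]

/-- **The `t–t'` Hubbard interaction is gauge invariant.** [cite: BratteliRobinsonII1997, §5.2.2] -/
theorem hubbardTTPrimeFermionInteraction_isGaugeInvariant (t t' U : ℝ) :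
    (hubbardTTPrimeFermionInteraction t t' U).IsGaugeInvariant :=
  FermionInteraction.isGaugeInvariant_of_add (hubbardTTPrimeFermionInteraction_apply t t' U)
    (hubbardFermionInteraction_isGaugeInvariant t U) (diagHoppingFermionInteraction_isGaugeInvariant t')

/-- **The grand-canonical `t–t'` Hubbard pencil `Φ(t,t',U) − μ·n` is gauge invariant.**
[cite: BratteliRobinsonII1997, §5.2.2] -/
theorem hubbardTTPrimeMuInteraction_isGaugeInvariant (t t' U μ : ℝ) :
    (hubbardTTPrimeMuInteraction t t' U μ).IsGaugeInvariant :=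
  FermionInteraction.isGaugeInvariant_pencil (hubbardTTPrimeFermionInteraction_isGaugeInvariant t t' U)
    numberInteraction_isGaugeInvariant _

/-- **The local singlet pair `P_x` has charge `−2`.** [cite: BratteliRobinsonII1997, §5.2.2] -/
theorem hasGaugeCharge_localPairAt (S : Finset (Site 2)) (g : Site 2 → ℝ) (x : Site 2) :
    HasGaugeCharge (-2) (localPairAt S g x) := by
  unfold localPairAt
  refine HasGaugeCharge.sum _ fun e _ => HasGaugeCharge.smul (HasGaugeCharge.sub ?_ ?_) _
  · exact hasGaugeCharge_annihilation_mul_annihilation _ _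
  · exact hasGaugeCharge_annihilation_mul_annihilation _ _

end Hubbard

/-! ## The gauge action on infinite-volume states -/

namespace InfVolFermionState

variable {d : ℕ}

/-- **The gauge transform `ω ∘ γ_θ`** of an infinite-volume state: `(gaugeShift θ ω)_Λ(A) = ω_Λ(γ_θ A)`
— again a state (positivity: `γ_θ(A⋆A) = (γ_θ A)⋆(γ_θ A)`; compatibility: `Γ(φ)` commutes with
`γ_θ`, `fermionEmbed_gaugeAut`). [cite: BratteliRobinsonII1997, §5.2.2] -/
def gaugeShift (θ : ℝ) (ω : InfVolFermionState d) : InfVolFermionState d where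
  expect Λ := ω.expect Λ ∘ₗ (gaugeAut θ).toLinearMap
  expect_one Λ := by
    rw [LinearMap.comp_apply, AlgHom.toLinearMap_apply, map_one, ω.expect_one]
  expect_nonneg Λ A := by
    rw [LinearMap.comp_apply, AlgHom.toLinearMap_apply, gaugeAut_conjTranspose_mul_self]
    exact ω.expect_nonneg _ _
  compatible Λ Λ' h A := by
    rw [LinearMap.comp_apply, AlgHom.toLinearMap_apply, LinearMap.comp_apply, AlgHom.toLinearMap_apply,
      ← fermionEmbed_gaugeAut, ω.compatible]

variable (ω : InfVolFermionState d)

/-- The local expectations of the gauge transform (definitional). [cite: BratteliRobinsonII1997, §5.2.2] -/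
theorem gaugeShift_expect (θ : ℝ) (Λ : Finset (Site d)) (A : FermionOp Λ) :
    (ω.gaugeShift θ).expect Λ A = ω.expect Λ (gaugeAut θ A) :=
  rfl

/-- `ω ∘ γ_0 = ω`. [cite: BratteliRobinsonII1997, §5.2.2] -/
@[simp] theorem gaugeShift_zero : ω.gaugeShift 0 = ω :=
  InfVolFermionState.ext fun Λ => LinearMap.ext fun A => by rw [gaugeShift_expect, gaugeAut_zero_apply]

/-- Group law `(ω ∘ γ_φ) ∘ γ_θ = ω ∘ γ_{φ+θ}`. [cite: BratteliRobinsonII1997, §5.2.2] -/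
theorem gaugeShift_gaugeShift (θ φ : ℝ) : (ω.gaugeShift φ).gaugeShift θ = ω.gaugeShift (φ + θ) :=
  InfVolFermionState.ext fun Λ => LinearMap.ext fun A => by
    rw [gaugeShift_expect, gaugeShift_expect, gaugeShift_expect, gaugeAut_gaugeAut]

/-- **On a charge-`q` observable the gauge transform multiplies by `e^{iqθ}`.**
[cite: BratteliRobinsonII1997, §5.2.2] -/
theorem gaugeShift_expect_of_hasGaugeCharge (θ : ℝ) {Λ : Finset (Site d)} {q : ℤ} {A : FermionOp Λ}
    (hA : HasGaugeCharge q A) : (ω.gaugeShift θ).expect Λ A = exp (I * θ * q) * ω.expect Λ A := by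
  rw [gaugeShift_expect, hA θ, map_smul, smul_eq_mul]

/-- Gauge transforms commute with lattice translations. [cite: ArakiMoriya2003, §4.1 Def. 4.3] -/
theorem shift_gaugeShift (v : Site d) (θ : ℝ) : (ω.gaugeShift θ).shift v = (ω.shift v).gaugeShift θ :=
  InfVolFermionState.ext fun Λ => LinearMap.ext fun A => by
    rw [shift_expect, gaugeShift_expect, gaugeShift_expect, shift_expect, fermionEmbed_gaugeAut]

/-- A translation-invariant state has translation-invariant gauge transforms.
[cite: ArakiMoriya2003, §4.1 Def. 4.5] -/
theorem IsTranslationInvariant.gaugeShift {ω : InfVolFermionState d} (h : ω.IsTranslationInvariant) (θ : ℝ) :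
    (ω.gaugeShift θ).IsTranslationInvariant := fun v => by
  rw [shift_gaugeShift, h v]

/-- Gauge transforms of even states are even (`Θ = γ_π` commutes with `γ_θ`). [cite: ArakiMoriya2003, §4.1 Def. 4.5] -/
theorem IsEven.gaugeShift {ω : InfVolFermionState d} (h : ω.IsEven) (θ : ℝ) : (ω.gaugeShift θ).IsEven :=
  fun Λ A => by rw [gaugeShift_expect, gaugeShift_expect, gaugeAut_parityAut, h]

/-- The gauge transform of a mixture is the mixture of the gauge transforms (the gauge action is affine
on the convex state space). [cite: BratteliRobinsonI1987, §4.3.1] -/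
theorem gaugeShift_mix (θ : ℝ) (t : ℝ) (ht₀ : 0 ≤ t) (ht₁ : t ≤ 1) (ω₁ ω₂ : InfVolFermionState d) :
    (mix t ht₀ ht₁ ω₁ ω₂).gaugeShift θ = mix t ht₀ ht₁ (ω₁.gaugeShift θ) (ω₂.gaugeShift θ) :=
  InfVolFermionState.ext fun _ => LinearMap.ext fun _ => rfl

/-- **`ω` is gauge invariant**: `ω ∘ γ_θ = ω` for all `θ` (a `U(1)`-SYMMETRIC state).
[cite: BratteliRobinsonII1997, §5.2.2] -/
def IsGaugeInvariant (ω : InfVolFermionState d) : Prop :=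
  ∀ θ : ℝ, ω.gaugeShift θ = ω

/-- **A gauge-invariant state vanishes on every observable of non-zero charge** (e.g. on the pair
operators `P_x`, charge `−2`): `ω(A) = e^{iqθ} ω(A)` for all `θ`, take `θ = π/q`.
[cite: BratteliRobinsonII1997, §5.2.2] -/
theorem IsGaugeInvariant.expect_eq_zero_of_hasGaugeCharge {ω : InfVolFermionState d} (hω : ω.IsGaugeInvariant)
    {Λ : Finset (Site d)} {q : ℤ} (hq : q ≠ 0) {A : FermionOp Λ} (hA : HasGaugeCharge q A) :
    ω.expect Λ A = 0 := by
  have h := ω.gaugeShift_expect_of_hasGaugeCharge (Real.pi / q) hA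
  rw [hω] at h
  have hphase : exp (I * ((Real.pi / q : ℝ) : ℂ) * q) = -1 := by
    have hq' : (q : ℂ) ≠ 0 := by exact_mod_cast hq
    rw [show I * ((Real.pi / q : ℝ) : ℂ) * q = Real.pi * I by push_cast; field_simp, Complex.exp_pi_mul_I]
  rw [hphase] at h
  have h2 : (2 : ℂ) * ω.expect Λ A = 0 := by linear_combination h
  exact (mul_eq_zero.1 h2).resolve_left two_ne_zero

/-- A gauge-invariant state is even (`Θ = γ_π`). [cite: ArakiMoriya2003, §4.1 Def. 4.5] -/
theorem IsGaugeInvariant.isEven {ω : InfVolFermionState d} (hω : ω.IsGaugeInvariant) : ω.IsEven := by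
  intro Λ A
  have h := congrArg (fun ω' : InfVolFermionState d => ω'.expect Λ A) (hω Real.pi)
  simp only [gaugeShift_expect] at h
  rw [← gaugeAut_pi]
  exact h

/-! ### The gauge average `ω ∘ E` -/

/-- **The gauge average `ω̄ = ∫ (ω ∘ γ_θ) dθ/2π = ω ∘ E`** of an infinite-volume state, realised
through the conditional expectation `E = gradedCompress Finset.card` onto the gauge-invariant algebra
(particle-number pinching): `(gaugeAverage ω)_Λ(A) = ω_Λ(E A)`. It is a state (positivity:
`E(A⋆A) = Σ_n (A P_n)⋆(A P_n)`; compatibility: `Γ(φ) ∘ E = E ∘ Γ(φ)`, `fermionEmbed_gradedCompress`),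
gauge invariant, and agrees with `ω` on gauge-invariant observables.
[cite: BratteliRobinsonII1997, §5.2.2] [cite: Petz2008, §9.2] -/
def gaugeAverage (ω : InfVolFermionState d) : InfVolFermionState d where
  expect Λ :=
    { toFun := fun A => ω.expect Λ (gradedCompress Finset.card A)
      map_add' := fun A B => by rw [gradedCompress_add, map_add]
      map_smul' := fun c A => by rw [gradedCompress_smul, map_smul, RingHom.id_apply] }
  expect_one Λ := by
    change ω.expect Λ (gradedCompress Finset.card 1) = 1
    rw [gradedCompress_of_hasGaugeCharge_zero HasGaugeCharge.one, ω.expect_one]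
  expect_nonneg Λ A := by
    change 0 ≤ ω.expect Λ (gradedCompress Finset.card (Aᴴ * A))
    rw [gradedCompress_eq_sum_sectorProj, map_sum]
    refine Finset.sum_nonneg fun q _ => ?_
    have h : Literature.LinearAlgebra.Matrix.sectorProj (R := ℂ) Finset.card q * (Aᴴ * A) *
          Literature.LinearAlgebra.Matrix.sectorProj (R := ℂ) Finset.card q =
        (A * Literature.LinearAlgebra.Matrix.sectorProj (R := ℂ) Finset.card q)ᴴ *
          (A * Literature.LinearAlgebra.Matrix.sectorProj (R := ℂ) Finset.card q) := by
      rw [Matrix.conjTranspose_mul, Literature.LinearAlgebra.Matrix.sectorProj_conjTranspose,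
        Matrix.mul_assoc, Matrix.mul_assoc, Matrix.mul_assoc]
    rw [h]
    exact ω.expect_nonneg _ _
  compatible Λ Λ' h A := by
    change ω.expect Λ' (gradedCompress Finset.card (fermionEmbed (PolySite.incl h) A)) =
      ω.expect Λ (gradedCompress Finset.card A)
    rw [← fermionEmbed_gradedCompress, ω.compatible]

/-- The local expectations of the gauge average (definitional). [cite: Petz2008, §9.2] -/
theorem gaugeAverage_expect (Λ : Finset (Site d)) (A : FermionOp Λ) :
    ω.gaugeAverage.expect Λ A = ω.expect Λ (gradedCompress Finset.card A) :=
  rfl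

/-- **The gauge average is gauge invariant.** [cite: BratteliRobinsonII1997, §5.2.2] -/
theorem gaugeAverage_isGaugeInvariant : ω.gaugeAverage.IsGaugeInvariant := fun θ =>
  InfVolFermionState.ext fun Λ => LinearMap.ext fun A => by
    rw [gaugeShift_expect, gaugeAverage_expect, gaugeAverage_expect, gradedCompress_gaugeAut]

/-- **On gauge-invariant observables the gauge average agrees with `ω`.** [cite: Petz2008, §9.2] -/
theorem gaugeAverage_expect_of_hasGaugeCharge_zero {Λ : Finset (Site d)} {A : FermionOp Λ}
    (hA : HasGaugeCharge 0 A) : ω.gaugeAverage.expect Λ A = ω.expect Λ A := by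
  rw [gaugeAverage_expect, gradedCompress_of_hasGaugeCharge_zero hA]

/-- On observables of non-zero charge the gauge average vanishes. [cite: Petz2008, §9.2] -/
theorem gaugeAverage_expect_of_hasGaugeCharge_ne_zero {Λ : Finset (Site d)} {q : ℤ} (hq : q ≠ 0)
    {A : FermionOp Λ} (hA : HasGaugeCharge q A) : ω.gaugeAverage.expect Λ A = 0 := by
  rw [gaugeAverage_expect, gradedCompress_of_hasGaugeCharge_ne_zero hq hA, map_zero]

/-- The gauge average only sees the gauge orbit: `gaugeAverage (ω ∘ γ_θ) = gaugeAverage ω`.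
[cite: Petz2008, §9.2] -/
theorem gaugeAverage_gaugeShift (θ : ℝ) : (ω.gaugeShift θ).gaugeAverage = ω.gaugeAverage :=
  InfVolFermionState.ext fun Λ => LinearMap.ext fun A => by
    rw [gaugeAverage_expect, gaugeAverage_expect, gaugeShift_expect, gaugeAut_gradedCompress]

/-- Gauge averaging commutes with lattice translations. [cite: ArakiMoriya2003, §4.1 Def. 4.3] -/
theorem shift_gaugeAverage (v : Site d) : ω.gaugeAverage.shift v = (ω.shift v).gaugeAverage :=
  InfVolFermionState.ext fun Λ => LinearMap.ext fun A => by
    rw [shift_expect, gaugeAverage_expect, gaugeAverage_expect, shift_expect, fermionEmbed_gradedCompress]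

/-- **The gauge average of a translation-invariant state is translation invariant.**
[cite: ArakiMoriya2003, §4.1 Def. 4.5] -/
theorem IsTranslationInvariant.gaugeAverage {ω : InfVolFermionState d} (h : ω.IsTranslationInvariant) :
    ω.gaugeAverage.IsTranslationInvariant := fun v => by
  rw [shift_gaugeAverage, h v]

/-- The gauge average is even. [cite: ArakiMoriya2003, §4.1 Def. 4.5] -/
theorem gaugeAverage_isEven : ω.gaugeAverage.IsEven :=
  ω.gaugeAverage_isGaugeInvariant.isEven

/-- The gauge average of a mixture is the mixture of the gauge averages (`ω ↦ ω ∘ E` is affine).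
[cite: BratteliRobinsonI1987, §4.3.1] -/
theorem gaugeAverage_mix (t : ℝ) (ht₀ : 0 ≤ t) (ht₁ : t ≤ 1) (ω₁ ω₂ : InfVolFermionState d) :
    (mix t ht₀ ht₁ ω₁ ω₂).gaugeAverage = mix t ht₀ ht₁ ω₁.gaugeAverage ω₂.gaugeAverage :=
  InfVolFermionState.ext fun _ => LinearMap.ext fun _ => rfl

/-- **A gauge-invariant state is its own gauge average** (it vanishes on the charged matrix units, so
`ω(A) = ω(E A)`). [cite: Petz2008, §9.2] -/
theorem IsGaugeInvariant.gaugeAverage_eq {ω : InfVolFermionState d} (hω : ω.IsGaugeInvariant) :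
    ω.gaugeAverage = ω := by
  refine InfVolFermionState.ext fun Λ => LinearMap.ext fun A => ?_
  rw [gaugeAverage_expect]
  conv_lhs => rw [Matrix.matrix_eq_sum_single A, gradedCompress_card_sum]
  conv_rhs => rw [Matrix.matrix_eq_sum_single A]
  simp only [gradedCompress_card_sum, map_sum]
  refine Finset.sum_congr rfl fun s _ => Finset.sum_congr rfl fun t _ => ?_
  rw [gradedCompress_of_hasGaugeCharge (hasGaugeCharge_single s t (A s t))]
  split_ifs with h
  · rfl
  · rw [map_zero, hω.expect_eq_zero_of_hasGaugeCharge h (hasGaugeCharge_single s t (A s t))]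

/-- `ω` is gauge invariant iff it equals its gauge average. [cite: Petz2008, §9.2] -/
theorem isGaugeInvariant_iff_gaugeAverage_eq : ω.IsGaugeInvariant ↔ ω.gaugeAverage = ω :=
  ⟨fun h => h.gaugeAverage_eq, fun h => h ▸ ω.gaugeAverage_isGaugeInvariant⟩

/-! ### Mean energy and ground states under the gauge action -/

/-- **The mean energy of a gauge-invariant interaction is gauge invariant**: `e_Φ(ω ∘ γ_θ) = e_Φ(ω)`.
[cite: BratteliKishimotoRobinson1978, §3 (mean energy functional)] -/
theorem meanEnergy_gaugeShift {Ψ : FermionInteraction d} (hΨ : Ψ.IsGaugeInvariant) (R θ : ℝ) :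
    (ω.gaugeShift θ).meanEnergy Ψ R = ω.meanEnergy Ψ R := by
  rw [InfVolFermionState.meanEnergy, InfVolFermionState.meanEnergy, gaugeShift_expect,
    FermionInteraction.gaugeAut_meanEnergyObs hΨ]

/-- **… and so is unchanged by the gauge average**: `e_Φ(ω̄) = e_Φ(ω)`.
[cite: BratteliKishimotoRobinson1978, §3 (mean energy functional)] -/
theorem meanEnergy_gaugeAverage {Ψ : FermionInteraction d} (hΨ : Ψ.IsGaugeInvariant) (R : ℝ) :
    ω.gaugeAverage.meanEnergy Ψ R = ω.meanEnergy Ψ R := by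
  rw [InfVolFermionState.meanEnergy, InfVolFermionState.meanEnergy, gaugeAverage_expect,
    FermionInteraction.gradedCompress_meanEnergyObs hΨ]

/-- **Gauge transforms of ground states are ground states** (mean-energy minimisers of a
gauge-invariant interaction). [cite: BratteliKishimotoRobinson1978, Thm. 2 (condition 2)] -/
theorem IsMeanEnergyMinimiser.gaugeShift {Ψ : FermionInteraction d} {R : ℝ} {ω : InfVolFermionState d}
    (hω : ω.IsMeanEnergyMinimiser Ψ R) (hΨ : Ψ.IsGaugeInvariant) (θ : ℝ) :
    (ω.gaugeShift θ).IsMeanEnergyMinimiser Ψ R :=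
  ⟨hω.1.gaugeShift θ, fun ω' hω' => by rw [meanEnergy_gaugeShift _ hΨ]; exact hω.2 ω' hω'⟩

/-- **The gauge average of a ground state is a (gauge-SYMMETRIC) ground state.**
[cite: BratteliKishimotoRobinson1978, Thm. 2 (condition 2)] -/
theorem IsMeanEnergyMinimiser.gaugeAverage {Ψ : FermionInteraction d} {R : ℝ} {ω : InfVolFermionState d}
    (hω : ω.IsMeanEnergyMinimiser Ψ R) (hΨ : Ψ.IsGaugeInvariant) :
    ω.gaugeAverage.IsMeanEnergyMinimiser Ψ R :=
  ⟨hω.1.gaugeAverage, fun ω' hω' => by rw [meanEnergy_gaugeAverage _ hΨ]; exact hω.2 ω' hω'⟩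

/-- **Mixtures of ground states are ground states** (the minimisers form a face, in particular a
convex set; converse of `of_mix_left/right`). [cite: BratteliKishimotoRobinson1978, Thm. 2 (condition 2)] -/
theorem IsMeanEnergyMinimiser.mix {Ψ : FermionInteraction d} {R : ℝ} {ω₁ ω₂ : InfVolFermionState d}
    (h₁ : ω₁.IsMeanEnergyMinimiser Ψ R) (h₂ : ω₂.IsMeanEnergyMinimiser Ψ R) (t : ℝ) (ht₀ : 0 ≤ t)
    (ht₁ : t ≤ 1) : (InfVolFermionState.mix t ht₀ ht₁ ω₁ ω₂).IsMeanEnergyMinimiser Ψ R := by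
  refine ⟨h₁.1.mix h₂.1 t ht₀ ht₁, fun ω' hω' => ?_⟩
  rw [meanEnergy_mix]
  have e₁ := h₁.2 ω' hω'
  have e₂ := h₂.2 ω' hω'
  nlinarith

/-! ### Pair amplitudes -/

/-- **The gauge transform rotates the pair amplitude**: `(ω ∘ γ_θ)(P_x) = e^{-2iθ} ω(P_x)`.
[cite: BratteliRobinsonII1997, §5.2.2] -/
theorem gaugeShift_expect_localPairAt (ω : InfVolFermionState 2) (θ : ℝ) (S : Finset (Site 2))
    (g : Site 2 → ℝ) (x : Site 2) :
    (ω.gaugeShift θ).expect (pairRegion S x) (localPairAt S g x) =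
      exp (-(2 * (I * θ))) * ω.expect (pairRegion S x) (localPairAt S g x) := by
  rw [ω.gaugeShift_expect_of_hasGaugeCharge θ (hasGaugeCharge_localPairAt S g x)]
  congr 1
  congr 1
  push_cast
  ring

/-- **A gauge-invariant state has zero pair amplitude**: `ω(P_x) = 0`. [cite: BratteliRobinsonII1997, §5.2.2] -/
theorem IsGaugeInvariant.expect_localPairAt_eq_zero {ω : InfVolFermionState 2} (hω : ω.IsGaugeInvariant)
    (S : Finset (Site 2)) (g : Site 2 → ℝ) (x : Site 2) :
    ω.expect (pairRegion S x) (localPairAt S g x) = 0 :=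
  hω.expect_eq_zero_of_hasGaugeCharge (by norm_num) (hasGaugeCharge_localPairAt S g x)

/-- In particular the gauge average has zero pair amplitude. [cite: BratteliRobinsonII1997, §5.2.2] -/
theorem gaugeAverage_expect_localPairAt (ω : InfVolFermionState 2) (S : Finset (Site 2)) (g : Site 2 → ℝ)
    (x : Site 2) : ω.gaugeAverage.expect (pairRegion S x) (localPairAt S g x) = 0 :=
  ω.gaugeAverage_isGaugeInvariant.expect_localPairAt_eq_zero S g x

end InfVolFermionState

end Literature.MathematicalPhysics.QuantumLattice

end
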